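import Summits.CriticalPhenomena.SAWScalingLimit.Theses.SAWTotalPositivity
import Summits.CriticalPhenomena.SAWScalingLimit.Theorems.SAWTotalPositivityBoundaryTP2Defs
import Summits.CriticalPhenomena.SAWScalingLimit.Theorems.SAWTotalPositivityBoundaryTP2Kernel
import Literature.Probability.RandomPlanarGeometry.SelfAvoidingWalkProofs
import HarnessLib

/-!
# SKELETON — crux `BoundaryTP2` (stmt-CriticalPhenomena-7115), line `infinite-room-injection`

Crux-plan skeleton (planner `cruxplan-…-7115-infinite-room-inject`, 2026-08-16) for the idea card
`Cruxes/BoundaryTP2/Ideas/infinite-room-injection.md` (triage r1-1/2/3: pass).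

## Spine (what `BoundaryTP2_of` composes)

`BoundaryTP2` ⟸ `GraphTP2At x_c` (LANDED transfer `boundaryTP2_of_graphTP2At`, …Theorems/…BoundaryTP2Kernel)
⟸ case split on `HasLegs` (four pairwise vertex-disjoint lattice legs from the marked points to a horizontal
line strictly below the graph, avoiding the graph):

* `stub_flatten`  — LEGS NORMAL FORM (x-free construction, provable now): an instance with legs is equivalent,
  up to a common monomial factor `x^k` on both sides, to a FLAT instance: a finite `H' ≤ ℤ²` lying in a closed
  upper half-plane `{y ≥ y₀}` with the four marked points ON the boundary line `y = y₀` in the order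
  `a < b < c < d`, crossing pairs `(b↔d, c↔a)`, nested pairs of RAINBOW type `(b↔c inner, d↔a outer)`.
  (Feet order is free up to cyclic rotation because legs may wrap around `H`; both orientations of the
  boundary cyclic order land on the rainbow type at the level of the two products.)
* `stub_flatTP2`  — the line's MAIN stub: `FlatTP2At x_c`, TP₂ at `x_c` for flat instances. This is the
  crux restricted to its half-plane-boundary normal form — the geometry in which the card's x-free conjecture
  (HP) (`Cruxes/BoundaryTP2/SketchIdeator1.lean: HalfPlaneCoeffTP2`; coefficientwise rainbow ≥ crossing in the FULL half-plane), strip transfer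
  matrices and Fekete chaining along a line all live.
* `stub_legless`  — RESIDUAL sub-case (no four disjoint legs): hole-face quadruples AND quadruples reached only
  through width-< 4 bays/slits of the complement. Outside this line's mechanism; a sub-case of the crux verbatim.

## Why the card's (HP) and "step two" are NOT stubs (planner's finding, see Lines/infinite-room-injection.md)

For ANY length-preserving injection `Φ : CR(ℍ) ↪ NE(ℍ)` and any finite `H ≤ ℍ`:
`N_H − C_H = NonIm_H(Φ) + In_H(Φ) − Esc_H(Φ)` (exact accounting). Hence the card's step two
`W(Esc_G) ≤ W(NE_G ∖ Φ(CR_G))` is EQUIVALENT to the TP₂ instance itself, for every `Φ`: as a statement it is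
the target in costume, and `(HP) ∧ (step two) = (HP) ∧ TP₂`. (HP) is therefore the line's x-free guide and
falsifier generator (typed as `HalfPlaneCoeffTP2` in `Cruxes/BoundaryTP2/SketchIdeator1.lean`; deliberately NOT restated
here and NOT in the spine), not a waypoint.
New data (planner, exact enumeration): infinite room OUTSIDE a hole gives coefficientwise positivity for the
8-cycle and 16-cycle holes through degree 22–24, but NOT for the interior unit plaquette of `ℤ²`
(`[x¹⁰](side² − diag²) = 428 − 432 = −4`, then −64, −584, …): room is a half-plane-boundary phenomenon.

## Disproof / negatives honoured

`boundaryTP2_false_without_interlacing` — interlacing is carried verbatim by every stub (`Interlaced`);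
`not_midpointTP2_all_fugacities` — the only fugacity-free stub is the monomial IDENTITY `stub_flatten`
(no inequality is claimed uniformly in `x`); `circularTP3_fails_at_xc` — order 2 only;
`exists_simplyConnected_domain_with_annular_meshGraph` — hole faces are in `stub_legless`, not claimed flat.
-/

noncomputable section

namespace Summit.CriticalPhenomena.SAWScalingLimit.Cruxes.BoundaryTP2.InfiniteRoomInjection

open Literature.Probability.LatticeModels Literature.Probability.RandomPlanarGeometry
open Summit.CriticalPhenomena.SAWScalingLimit.Theorems.BoundaryTP2
open scoped ENNReal

/-! ## Vocabulary of the line (to be moved verbatim into a reviewed `…BoundaryTP2FlatDefs.lean` by the lead) -/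

/-- **Legs.** The marked quadruple `p₁ p₂ p₃ p₄` of `H` *has legs* if there are four pairwise
vertex-disjoint self-avoiding lattice paths `Lᵢ : pᵢ → qᵢ` of `ℤ²` whose feet `qᵢ` lie strictly below every
non-isolated vertex of `H` and which meet the non-isolated vertices of `H` only at their starting points.
(Lattice form of "the four points are accessible from infinity"; it fails for hole faces and for points inside
bays of the complement too narrow to let four disjoint lattice paths out.) -/
def HasLegs (H : SimpleGraph (Site 2)) (p₁ p₂ p₃ p₄ : Site 2) : Prop :=
  ∃ (q : Fin 4 → Site 2) (L : (i : Fin 4) → (zdGraph 2).Walk (![p₁, p₂, p₃, p₄] i) (q i)),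
    (∀ i, (L i).IsPath) ∧
    (∀ i, ∀ v ∈ H.support, q i 1 < v 1) ∧
    (∀ i, ∀ v ∈ (L i).support, v ∈ H.support → v = ![p₁, p₂, p₃, p₄] i) ∧
    (∀ i j, i ≠ j → List.Disjoint (L i).support (L j).support)

/-- **Flat TP₂ at fugacity `x`** (the line's normal form of the crux): for every subgraph `H ≤ ℤ²` with
finitely many non-isolated vertices, all of height `≥ y₀`, and boundary-line points
`A = (a,y₀), B = (b,y₀), C = (c,y₀), D = (d,y₀)` with `a < b < c < d` such that (i) every path `B → D` meets
every path `C → A`, (ii) `(B C | D A)` and (iii) `(B A | C D)` are realisable by vertex-disjoint paths: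
`Z(B,D)·Z(C,A) ≤ Z(B,C)·Z(D,A)` — crossing ≤ RAINBOW (inner `B↔C`, outer `D↔A`), `Z = pathKernel H x`.
Instances of `GraphTP2At x` with `(p₁,p₂,p₃,p₄) = (B,C,D,A)` (`flatTP2At_of_graphTP2At`). -/
def FlatTP2At (x : ℝ) : Prop :=
  ∀ (H : SimpleGraph (Site 2)) (y₀ a b c d : ℤ), H ≤ zdGraph 2 → H.support.Finite →
    (∀ v ∈ H.support, y₀ ≤ v 1) → a < b → b < c → c < d →
      Interlaced H ![b, y₀] ![c, y₀] ![d, y₀] ![a, y₀] →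
        DisjointPaths H ![b, y₀] ![c, y₀] ![d, y₀] ![a, y₀] →
          DisjointPaths H ![b, y₀] ![a, y₀] ![c, y₀] ![d, y₀] →
            pathKernel H x ![b, y₀] ![d, y₀] * pathKernel H x ![c, y₀] ![a, y₀] ≤
              pathKernel H x ![b, y₀] ![c, y₀] * pathKernel H x ![d, y₀] ![a, y₀]

/-- Sanity: flat instances ARE instances of the combinatorial core (so the main stub is not stronger than
the crux's core): specialise `GraphTP2At x` at `(p₁,p₂,p₃,p₄) = (B,C,D,A)`. -/
theorem flatTP2At_of_graphTP2At {x : ℝ} (h : GraphTP2At x) : FlatTP2At x := by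
  intro H y₀ a b c d hH hfin _ _ _ _ hI hD₁ hD₂
  exact h H hH hfin _ _ _ _ hI hD₁ hD₂

/-! ## Registered stubs -/

/-- STUB (legs normal form; x-free CONSTRUCTION, provable now; size L). If the marked quadruple of an
instance of the core has legs, then there is a flat instance `(H', y₀, a<b<c<d)` — `H` together with four
re-routed pairwise disjoint legs whose feet land on one horizontal line in an order realising the RAINBOW
type — satisfying (i)–(iii), whose crossing product and rainbow product are `x^k` times the crossing
product `Z(p₁,p₃)Z(p₂,p₄)` and the nested product `Z(p₁,p₂)Z(p₃,p₄)` of the original instance, for every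
`x ≥ 0` (`k` = total leg length; feet have degree one, so every `H'`-path between feet is leg·(H-path)·leg).
Ingredients: wrap legs around `H` to rotate the foot order (both boundary orientations work at the level of
products, by `pathKernel_comm`); cut each leg at its first visit to the common level; pendant-path
factorisation of `pathKernel`; interlacing/disjointness transfer through the legs. -/
theorem stub_flatten (H : SimpleGraph (Site 2)) (hH : H ≤ zdGraph 2) (hfin : H.support.Finite)
    (p₁ p₂ p₃ p₄ : Site 2) (hI : Interlaced H p₁ p₂ p₃ p₄) (hD₁ : DisjointPaths H p₁ p₂ p₃ p₄)
    (hD₂ : DisjointPaths H p₁ p₄ p₂ p₃) (hL : HasLegs H p₁ p₂ p₃ p₄) :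
    ∃ (H' : SimpleGraph (Site 2)) (y₀ a b c d : ℤ) (k : ℕ),
      H' ≤ zdGraph 2 ∧ H'.support.Finite ∧ (∀ v ∈ H'.support, y₀ ≤ v 1) ∧ a < b ∧ b < c ∧ c < d ∧
      Interlaced H' ![b, y₀] ![c, y₀] ![d, y₀] ![a, y₀] ∧
      DisjointPaths H' ![b, y₀] ![c, y₀] ![d, y₀] ![a, y₀] ∧
      DisjointPaths H' ![b, y₀] ![a, y₀] ![c, y₀] ![d, y₀] ∧
      ∀ x : ℝ, 0 ≤ x →
        pathKernel H' x ![b, y₀] ![d, y₀] * pathKernel H' x ![c, y₀] ![a, y₀] =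
            ENNReal.ofReal (x ^ k) * (pathKernel H x p₁ p₃ * pathKernel H x p₂ p₄) ∧
        pathKernel H' x ![b, y₀] ![c, y₀] * pathKernel H' x ![d, y₀] ![a, y₀] =
            ENNReal.ofReal (x ^ k) * (pathKernel H x p₁ p₂ * pathKernel H x p₃ p₄) := by
  sorry

/-- STUB (MAIN, hardest; size XL; equivalent to the crux on instances with legs). TP₂ at `x_c` for flat
instances: finite `H ≤ ℤ²` in a closed upper half-plane, marked points on its boundary line,
crossing ≤ rainbow. The card's mechanism lives here: (HP) (`HalfPlaneCoeffTP2`) is the statement that the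
coefficients of rainbow − crossing of `H` agree with NONNEGATIVE half-plane coefficients up to the degree at
which pairs feel `ℍ ∖ H`; what remains is the x_c-dependent sign of the jammed tail (data: first negative
coefficient at degree 12–24 on boxes, thresholds `x₀(H) ↓ x_c⁺`, margins `→ 0⁺` like `L^{-3.5}`). Any
escape-pricing formulation of that remainder is equivalent to this stub (module docstring). -/
theorem stub_flatTP2 : FlatTP2At SAW.criticalFugacity := by
  sorry

/-- STUB (RESIDUAL sub-case of the core, size L–XL; outside this line's mechanism). TP₂ at `x_c` for
instances of the core whose marked quadruple has NO legs: quadruples on hole faces (the typed crux contains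
annular mesh graphs, `exists_simplyConnected_domain_with_annular_meshGraph`) and quadruples accessible from
infinity only through bays of the complement too narrow for four disjoint lattice legs (this includes the
refuters' deep-slit families). First step for a prover: the duality lemma "no legs ⇒ a small vertex cut of
`ℤ² ∖ H.support` separates the quadruple from infinity", then cut-vertex / one- and two-edge-cut
factorisations (`stub_cutVertex_factor`, `stub_oneEdgeCut_factor`, `stub_twoEdgeCut_factor`, landed) to
reduce bottleneck configurations; hole faces have no reduction in this line (and no coefficientwise room
phenomenon for the interior plaquette: planner's data). -/
theorem stub_legless (H : SimpleGraph (Site 2)) (hH : H ≤ zdGraph 2) (hfin : H.support.Finite)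
    (p₁ p₂ p₃ p₄ : Site 2) (hI : Interlaced H p₁ p₂ p₃ p₄) (hD₁ : DisjointPaths H p₁ p₂ p₃ p₄)
    (hD₂ : DisjointPaths H p₁ p₄ p₂ p₃) (hL : ¬ HasLegs H p₁ p₂ p₃ p₄) :
    pathKernel H SAW.criticalFugacity p₁ p₃ * pathKernel H SAW.criticalFugacity p₂ p₄ ≤
      pathKernel H SAW.criticalFugacity p₁ p₂ * pathKernel H SAW.criticalFugacity p₃ p₄ := by
  sorry

/-! ## Composition -/

/-- The combinatorial core at `x_c` from the three stubs: split on `HasLegs`; with legs, flatten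
(`stub_flatten`), apply the flat TP₂ (`stub_flatTP2`) and cancel the common monomial `x_c^k ≠ 0, ≠ ∞`;
without legs, `stub_legless`. -/
theorem graphTP2At_criticalFugacity : GraphTP2At SAW.criticalFugacity := by
  intro H hH hfin p₁ p₂ p₃ p₄ hI hD₁ hD₂
  by_cases hL : HasLegs H p₁ p₂ p₃ p₄
  · obtain ⟨H', y₀, a, b, c, d, k, hH', hfin', hup, hab, hbc, hcd, hI', hD₁', hD₂', hZ⟩ :=
      stub_flatten H hH hfin p₁ p₂ p₃ p₄ hI hD₁ hD₂ hL
    obtain ⟨hC, hN⟩ := hZ SAW.criticalFugacity SAW.criticalFugacity_pos_lt_one'.1.le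
    have h := stub_flatTP2 H' y₀ a b c d hH' hfin' hup hab hbc hcd hI' hD₁' hD₂'
    rw [hC, hN] at h
    have h0 : ENNReal.ofReal (SAW.criticalFugacity ^ k) ≠ 0 :=
      (ENNReal.ofReal_pos.2 (pow_pos SAW.criticalFugacity_pos_lt_one'.1 k)).ne'
    exact (ENNReal.mul_le_mul_iff_right h0 ENNReal.ofReal_ne_top).mp h
  · exact stub_legless H hH hfin p₁ p₂ p₃ p₄ hI hD₁ hD₂ hL

/-- **Composition of the line**: the crux `BoundaryTP2`, BY NAME, from the registered stubs
`stub_flatten`, `stub_flatTP2`, `stub_legless` through the landed transfer `boundaryTP2_of_graphTP2At`. -/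
theorem BoundaryTP2_of :
    Summit.CriticalPhenomena.SAWScalingLimit.Theses.SAWTotalPositivity.BoundaryTP2 :=
  boundaryTP2_of_graphTP2At graphTP2At_criticalFugacity

end Summit.CriticalPhenomena.SAWScalingLimit.Cruxes.BoundaryTP2.InfiniteRoomInjection
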